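import Summits.ResolutionOfSingularities.ResolutionOfSingularities.Theorems.PurelyInseparableDim4JointForestRootWaitingMembers
import Summits.ResolutionOfSingularities.ResolutionOfSingularities.Theorems.PurelyInseparableDim4JointForestDepthTwoKit
import HarnessLib

/-!
# Purely inseparable four-folds: the DEPTH-TWO CERTIFICATE KIT WITH WAITING MEMBERS, OTHER MEMBERS AND ISOLATED POINTS (brick S3 (c)
# «joint point∘coordinate chains», part 50 = v3-lite-full kit with points; cell `res-dim4-pi`)

[OURS · counted 0] (D-0157 DOOR 2; desk WORD #66 (4)(c), #74 (g), #99 (d); frame `PIDim4.TerminationImpliesOrderReduction`, S3 (c)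
v3-lite; host item stmt-ResolutionOfSingularities-16155, helper). Nothing here proves resolution of singularities in dimension ≥ 4 /
characteristic `p` — NOT here, not anywhere in this programme.

Part 46's kit PLUS finitely many ISOLATED root points dead after one point blow-up, as a user-facing corollary of part 42b: supply
additionally a finite set `Rt` of root parameters `b′` (each with NO equimultiple pair for the point centre on its re-centred cleaned
state) and the FOUR-WAY root cover «host on `S₀`, or a waiting member on `T`, or a member on `S₁`, or `b′ ∈ Rt`».

* **`exists_isMarkedResolution_depth_two_waiting_members_points_cert`** ⇒ `(𝔸⁵_K, (z^p + F)·𝒪, [], p)` admits a marked resolution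
  (BGMW Def. 3.1.3).

AI-produced formalisation, weaker than expert review. bears_on: LADDER-RESOLUTION:D157-DOOR2 (res-dim4-pi · S3 (c) joint v3-lite-full · kit).
-/

set_option linter.dupNamespace false -- D-0017: single-problem summit path `Summit.<S>.<S>.…` by design

noncomputable section

open MvPolynomial Finset CategoryTheory AlgebraicGeometry Opposite TopologicalSpace

namespace Summit.ResolutionOfSingularities.ResolutionOfSingularities.Theorems.PIDim4

open Literature.AlgebraicGeometry.Resolution
open Literature.AlgebraicGeometry.Resolution.Hauser2010
open Literature.AlgebraicGeometry.Resolution.AffinePointBlowup (P A γ coord Wtop ξ)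

namespace Equimultiple

section KitWaitingMembersPoints

variable {K : Type} [Field K] {p : ℕ} [hp : Fact p.Prime] [CharP K p]

/-- **DEPTH-TWO CERTIFICATE KIT WITH WAITING MEMBERS, OTHER MEMBERS AND ISOLATED POINTS.** See the module docstring.
[cite: BierstoneGrigorievMilmanWlodarczyk2011, Def. 3.1.3] [cite: HauserPerlega2019PRIMS, §2 (permissible centres P = (z, x_i : i ∈ Γ))]
[cite: Hauser2010, §F (equiconstant points)] -/
theorem exists_isMarkedResolution_depth_two_waiting_members_points_cert [IsAlgClosed K] [DecidableEq K] (F : MvPolynomial (Fin 4) K)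
    (hF : F ≠ 0) (hclean : Literature.Barriers.ResolutionOfSingularities.HauserPerlega.IsClean p F) (b₀ : Fin 4 → K)
    (S₀ : Finset (Fin 4)) (s₀ : State K) (hs₀ : s₀ = ⟨deletePthPowers p (PointBlowup.translate b₀ F), 0, ∅⟩)
    (hS₀ : IsPermissibleCentre p S₀ s₀.F)
    (Pl : Finset (Fin 4 × (Fin 4 → K) × Finset (Fin 4))) (Wt : Finset (Fin 4 × (Fin 4 → K) × Finset (Fin 4)))
    (L : Finset (Fin 4 × (Fin 4 → K)))
    (hP1 : ∀ e ∈ Pl, e.1 ∈ S₀ ∧ e.2.1 e.1 = 0 ∧ S₀ ⊆ e.2.2 ∧ CentreBlowup.IsEquimultiplePoint p S₀ e.1 e.2.1 s₀ ∧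
      IsPermissibleCentre p e.2.2 (CentreBlowup.step p S₀ e.1 e.2.1 s₀).F)
    (hP2 : ∀ e ∈ Pl, ∀ e' ∈ Pl, e ≠ e' →
      (e.1 = e'.1 ∧ ∃ i ∈ e.2.2, i ∈ e'.2.2 ∧ e.2.1 i ≠ e'.2.1 i) ∨
      (e.1 ≠ e'.1 ∧ ((e'.2.1 e.1 = 0 ∧ e.1 ∈ e'.2.2) ∨ (e.2.1 e'.1 = 0 ∧ e'.1 ∈ e.2.2))))
    (hW1 : ∀ wt ∈ Wt, wt.1 ∈ S₀ ∧ (∀ i ∈ S₀, wt.2.1 i = 0) ∧ S₀.erase wt.1 ⊆ wt.2.2 ∧ wt.1 ∉ wt.2.2 ∧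
      IsPermissibleCentre p wt.2.2 (PointBlowup.translate wt.2.1 s₀.F))
    (hW2 : ∀ wt ∈ Wt, ∀ wt' ∈ Wt, wt ≠ wt' → wt.1 = wt'.1 → ∃ i ∈ wt.2.2, i ∈ wt'.2.2 ∧ wt.2.1 i ≠ wt'.2.1 i)
    (hPW : ∀ e ∈ Pl, ∀ wt ∈ Wt, e.1 = wt.1 → ∃ i ∈ e.2.2, i ∈ wt.2.2 ∧ e.2.1 i ≠ wt.2.1 i)
    (hcover : ∀ (j' : Fin 4) (b' : Fin 4 → K), j' ∈ S₀ → b' j' = 0 → (∀ k ∈ S₀, k < j' → b' k = 0) →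
      CentreBlowup.IsEquimultiplePoint p S₀ j' b' s₀ →
      (∃ e ∈ Pl, e.1 = j' ∧ ∀ i ∈ e.2.2, b' i = e.2.1 i) ∨ (∃ wt ∈ Wt, wt.1 = j' ∧ ∀ i ∈ wt.2.2, b' i = wt.2.1 i) ∨
        (j', b') ∈ L)
    (mem : Finset ((Fin 4 → K) × Finset (Fin 4)))
    (hmem : ∀ bS ∈ mem, IsPermissibleCentre p bS.2 (deletePthPowers p (PointBlowup.translate bS.1 F)))
    (hsep : ∀ bS ∈ mem, ∀ bS' ∈ mem, bS ≠ bS' → ∃ i ∈ bS.2, i ∈ bS'.2 ∧ bS.1 i ≠ bS'.1 i)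
    (hsep₀ : ∀ bS ∈ mem, ∃ i ∈ bS.2, i ∈ S₀ ∧ bS.1 i ≠ b₀ i)
    (hWsep : ∀ bS ∈ mem, ∀ wt ∈ Wt, ∃ i ∈ bS.2, i ∈ wt.2.2 ∧ bS.1 i ≠ b₀ i + wt.2.1 i)
    (Rt : Finset (Fin 4 → K))
    (hroots : ∀ b' : Fin 4 → K,
      (∀ d : Fin 4 →₀ ℕ, d ≠ 0 → d.degree < p → coeff d (PointBlowup.translate b' F) = 0) →
      (∀ i ∈ S₀, b' i = b₀ i) ∨ (∃ wt ∈ Wt, ∀ i ∈ wt.2.2, b' i = b₀ i + wt.2.1 i) ∨ (∃ bS ∈ mem, ∀ i ∈ bS.2, b' i = bS.1 i) ∨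
        b' ∈ Rt)
    (hdead_child : ∀ e ∈ Pl, ∀ (j'' : Fin 4) (b'' : Fin 4 → K), j'' ∈ e.2.2 → b'' j'' = 0 →
      ¬ CentreBlowup.IsEquimultiplePoint p e.2.2 j'' b'' (CentreBlowup.step p S₀ e.1 e.2.1 s₀))
    (hdead_wkid : ∀ wt ∈ Wt, ∀ (j'' : Fin 4) (b'' : Fin 4 → K), j'' ∈ wt.2.2 → b'' j'' = 0 →
      ¬ CentreBlowup.IsEquimultiplePoint p wt.2.2 j'' b'' (CentreBlowup.step p S₀ wt.1 wt.2.1 s₀))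
    (hdead_leaf : ∀ l ∈ L, ∀ (k : Fin 4) (c : Fin 4 → K), c k = 0 →
      ¬ CentreBlowup.IsEquimultiplePoint p Finset.univ k c (CentreBlowup.step p S₀ l.1 l.2 s₀))
    (hdead_mem : ∀ bS ∈ mem, ∀ (j'' : Fin 4) (b'' : Fin 4 → K), j'' ∈ bS.2 → b'' j'' = 0 →
      ¬ CentreBlowup.IsEquimultiplePoint p bS.2 j'' b''
        (⟨deletePthPowers p (PointBlowup.translate bS.1 F), 0, ∅⟩ : State K))
    (hdead_pt : ∀ b' ∈ Rt, ∀ (k : Fin 4) (c : Fin 4 → K), c k = 0 →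
      ¬ CentreBlowup.IsEquimultiplePoint p Finset.univ k c
        (⟨deletePthPowers p (PointBlowup.translate b' F), 0, ∅⟩ : State K)) :
    ∃ (X' : Scheme.{0}) (ρ : X' ⟶ P 4 K) (M' : MarkedIdeal X'),
      IsMarkedResolution (⟨hypSheaf p F, [], p⟩ : MarkedIdeal (P 4 K)) ρ M' := by
  classical
  -- the rules below the first stage: nothing planned, no leaves
  let plan : State K → Finset (Fin 4) → Finset (Fin 4 × (Fin 4 → K) × Finset (Fin 4)) := fun _ _ => ∅
  let leaves : State K → Finset (Fin 4) → Finset (Fin 4 × (Fin 4 → K)) := fun _ _ => ∅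
  have hreach : ∀ q₀ q : State K × Finset (Fin 4),
      Relation.ReflTransGen (fun q q' : State K × Finset (Fin 4) =>
        ∃ e ∈ plan q.1 q.2, q' = (CentreBlowup.step p q.2 e.1 e.2.1 q.1, e.2.2)) q₀ q → q = q₀ := by
    intro q₀ q hq
    induction hq with
    | refl => rfl
    | tail _ hR _ =>
      obtain ⟨e, he, -⟩ := hR
      exact absurd he (Finset.notMem_empty e)
  have hacc : ∀ q₀ : State K × Finset (Fin 4), Acc (fun q' q : State K × Finset (Fin 4) =>
      ∃ e ∈ plan q.1 q.2, q' = (CentreBlowup.step p q.2 e.1 e.2.1 q.1, e.2.2)) q₀ := fun q₀ =>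
    Acc.intro _ fun q' ⟨e, he, _⟩ => absurd he (Finset.notMem_empty e)
  -- a dead pair satisfies the v2 block with empty plan and leaves
  have hdead : ∀ q : State K × Finset (Fin 4),
      (∀ (j'' : Fin 4) (b'' : Fin 4 → K), j'' ∈ q.2 → b'' j'' = 0 → ¬ CentreBlowup.IsEquimultiplePoint p q.2 j'' b'' q.1) →
      (∀ e ∈ plan q.1 q.2, e.1 ∈ q.2 ∧ e.2.1 e.1 = 0 ∧ q.2 ⊆ e.2.2 ∧
          CentreBlowup.IsEquimultiplePoint p q.2 e.1 e.2.1 q.1 ∧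
          IsPermissibleCentre p e.2.2 (CentreBlowup.step p q.2 e.1 e.2.1 q.1).F) ∧
      (∀ e ∈ plan q.1 q.2, ∀ e' ∈ plan q.1 q.2, e ≠ e' →
          (e.1 = e'.1 ∧ ∃ i ∈ e.2.2, i ∈ e'.2.2 ∧ e.2.1 i ≠ e'.2.1 i) ∨
          (e.1 ≠ e'.1 ∧ ((e'.2.1 e.1 = 0 ∧ e.1 ∈ e'.2.2) ∨ (e.2.1 e'.1 = 0 ∧ e'.1 ∈ e.2.2)))) ∧
      (∀ l ∈ leaves q.1 q.2, CentreBlowup.IsEquimultiplePoint p q.2 l.1 l.2 q.1 →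
          Acc (fun s' s : State K => Edge p Finset.univ s s') (CentreBlowup.step p q.2 l.1 l.2 q.1) ∧
          ∀ s' : State K, Relation.ReflTransGen (fun a e : State K => Edge p Finset.univ a e)
              (CentreBlowup.step p q.2 l.1 l.2 q.1) s' →
            {jb : Fin 4 × (Fin 4 → K) | jb.2 jb.1 = 0 ∧
              CentreBlowup.IsEquimultiplePoint p Finset.univ jb.1 jb.2 s'}.Finite) ∧
      (∀ (j' : Fin 4) (b' : Fin 4 → K), j' ∈ q.2 → b' j' = 0 → (∀ k ∈ q.2, k < j' → b' k = 0) →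
          CentreBlowup.IsEquimultiplePoint p q.2 j' b' q.1 →
          (∃ e ∈ plan q.1 q.2, e.1 = j' ∧ ∀ i ∈ e.2.2, b' i = e.2.1 i) ∨ (j', b') ∈ leaves q.1 q.2) :=
    fun q hq => ⟨fun e he => absurd he (Finset.notMem_empty e), fun e he => absurd he (Finset.notMem_empty e),
      fun l hl => absurd hl (Finset.notMem_empty l), fun j' b' hj' hb' _ heq => absurd heq (hq j' b' hj' hb')⟩
  have hsub : {b' : Fin 4 → K | (∀ d : Fin 4 →₀ ℕ, d ≠ 0 → d.degree < p →
      coeff d (PointBlowup.translate b' F) = 0) ∧ (¬ ∀ i ∈ S₀, b' i = b₀ i) ∧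
      (∀ wt ∈ Wt, ¬ ∀ i ∈ wt.2.2, b' i = b₀ i + wt.2.1 i) ∧ ∀ bS ∈ mem, ¬ ∀ i ∈ bS.2, b' i = bS.1 i} ⊆ (Rt : Set (Fin 4 → K)) := by
    rintro b' ⟨H, h₀, hW, hM⟩
    rcases hroots b' H with h | ⟨wt, hwt, h⟩ | ⟨bS, hbS, h⟩ | h
    · exact absurd h h₀
    · exact absurd h (hW wt hwt)
    · exact absurd h (hM bS hbS)
    · exact h
  refine exists_isMarkedResolution_joint_forest_root_waiting_members (p := p) F hF hclean plan leaves b₀ S₀ s₀ hs₀ hS₀ Pl Wt L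
    hP1 hP2 hW1 hW2 hPW (fun l hl _ => ⟨acc_edge_of_no_pairs _ (hdead_leaf l hl),
      fun s' hs' => finite_pairs_of_no_pairs _ (hdead_leaf l hl) s' hs'⟩) hcover (fun q hq => ?_)
    (fun e _ => hacc _) (fun wt _ => hacc _) mem (fun bS hbS => ⟨hmem bS hbS, fun q hq => ?_, hacc _⟩) hsep hsep₀ hWsep
    ((Finset.finite_toSet Rt).subset hsub) (fun b' H h₀ hW hM => ?_)
  · rcases hq with ⟨e, he, hq⟩ | ⟨wt, hwt, hq⟩
    · rw [hreach _ q hq]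
      exact hdead _ (hdead_child e he)
    · rw [hreach _ q hq]
      exact hdead _ (hdead_wkid wt hwt)
  · rw [hreach _ q hq]
    exact hdead _ (hdead_mem bS hbS)
  · have hb : b' ∈ Rt := hsub ⟨H, h₀, hW, hM⟩
    exact ⟨acc_edge_of_no_pairs _ (hdead_pt b' hb), fun s' hs' => finite_pairs_of_no_pairs _ (hdead_pt b' hb) s' hs'⟩

end KitWaitingMembersPoints

end Equimultiple

end Summit.ResolutionOfSingularities.ResolutionOfSingularities.Theorems.PIDim4

end
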